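import Mathlib
import Summits.NavierStokesRegularity.NavierStokesRegularity.Theorems.EulerZoomLiouvillePowerGaugeEulerLiouvilleNeedleRaceTools
import Summits.NavierStokesRegularity.NavierStokesRegularity.Theorems.EulerZoomLiouvillePowerGaugeEulerLiouvilleSelfSimilarSublinearConfinement
import HarnessLib.Audit
/-!
# Crux E `EulerZoomLiouville.PowerGaugeEulerLiouville` — the needle stratum: THE FEEDING-TIME RACE
# (ROUND-37 §1 (R), §2 (5)–(6)): an axisymmetric swirl-free `C²` profile with super-polynomially thin
# fast exits is irrotational

Route №10 `EulerZoomLiouville` (NavierStokesRegularity), crux E = stmt-NavierStokesRegularity-19832,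
registered residue `stub_selfSimilarC2Needle`, memo ROUND-37 of the cell `ns-regularity-ideate`
(text custody nsreg-p2), step **(R)**: the assembly of the three landed laws of the race —

* the STAY-SET CLOCK LAW (t38e, `NeedleStayClock.volume_image_toReal_le_of_stay`): vortical points with
  `|ω_θ|/r⊥ ≥ ξ₀` whose backward similarity orbit lingers in `‖·‖ ≤ 2R` for a time `S` have volume
  `≤ √(32·2R·B) ξ₀⁻¹ e^{−(1−2γ)S}` (`B` = enstrophy of the ball);
* the PER-LABEL FEEDING LAW (t38f, `NeedleFeeding.volume_toReal_le_feeding_of_exit`): an orbit that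
  exits through the shell `R ≤ ‖·‖ ≤ 2R` pays `|G|/(4R) ≤ √(time in the tube N)·√(energy seen in N)`,
  provided every strictly γ-fast point on a good sphere (`‖z‖² ∈ G`) lies in the tube `N` (LEMMA K);
* the LABEL-INTEGRATED FEEDING LAW (t38g, `NeedleFeeding.ofReal_mul_volume_le_feeding`): hence the
  exiting labels `X` satisfy `(|G|/4R)·|X| ≤ c_S √(|N| ∫_N ‖V‖²)`, `c_S = (e^{3γS} − 1)/(3γ)`;

into **`curl_eq_zero_of_thinFastExits`**: if `(U, P)` is a `C²` self-similar Euler profile (CIV (3.3),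
`IsSelfSimilarEulerProfile γ 0 U P`) with `0 < γ < ½`, axisymmetric and swirl-free, with polynomial
enstrophy growth `∫_{B̄_L} ‖curl U‖² ≤ C_Ω L^q` (`L ≥ 1`), and with SUPER-POLYNOMIALLY THIN FAST EXITS —
for every `m`, for all large `R`, a measurable set `G ⊆ [R², 4R²]` of good squared radii with
`|G| ≥ κR²` and a measurable tube `N ⊆ B̄_{2R}` catching every strictly γ-fast point of the good spheres,
with `|N| · ∫_N ‖U‖² ≤ R^{−m}` — then `curl U ≡ 0`.

THE RACE (proof): if `curl U x₀ ≠ 0`, a small ball `B₀ ∋ x₀` off the axis carries `‖Ω‖ ≥ ξ₀ r⊥`,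
volume `v₀ > 0`.  Cut `U` off outside a large ball (LEAD idiom, `Loc.exists_cutoff_local`) and run the
backward similarity flow for the time `S = s₁ log R`: the labels of `B₀` either STAY in `‖·‖ ≤ 2R` on
`[0,S]` — volume `≤ K₃ R^{(1+q)/2} R^{−(1−2γ)s₁} = K₃/R` for `s₁ = ((1+q)/2 + 1)/(1−2γ)` — or EXIT —
volume `≤ (4/(κR)) c_S R^{−m/2} ≤ K₄ R^{3γ s₁ − 1 − m/2} ≤ K₄/R` for `m = 6γ s₁`.  Both are `< v₀/2`
for `R` large: contradiction.  Only the EXPONENT of the exit-tube smallness matters; with Chebyshev-thin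
tubes (`m` fixed and small) the race is lost, with the capacity-thin tubes of ROUND-36/Lemma K (`m`
arbitrary) it is won — ROUND-37 §3, row 4.

Tools (the blob `exists_vortical_ball`, the two halves `volume_stay_le` / `ofReal_mul_volume_exit_le` against
the landed laws, the exponent race `race_arith`) are in `…NeedleRaceTools`.  NOT here: Lemma K and the
class budgets that discharge the thin-exit hypothesis for an in-class extremal profile (ROUND-37 (K),
t37c `NeedleSphereThinness.exists_thin_sphere` + t38a `NeedleAxisymBand.sin_le_of_band`), and the
member-level stratum (S37) — separate files.

References: Constantin–Ignatova–Vicol arXiv:2602.17570 §3.4.1 (3.21)–(3.22), §3.5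
[ConstantinIgnatovaVicol2026Putative]; KNSS 2009 Remark 5.1 (`ω_θ/r`) [KochNadirashviliSereginSverak2009];
(Cauchy–Schwarz, area formula, exp beats powers) [folklore].
-/

noncomputable section

-- the summit and its single problem share the name `NavierStokesRegularity` (D-0017 nested layout)
set_option linter.dupNamespace false

open Set Filter Topology Metric Function MeasureTheory InnerProductSpace
open scoped RealInnerProductSpace NNReal ENNReal

namespace Summit.NavierStokesRegularity.NavierStokesRegularity.Theorems.PowerGaugeEulerLiouville.NeedleRace

open Literature.Analysis Literature.Analysis.FluidPDE
open Summit.NavierStokesRegularity.NavierStokesRegularity.Theorems.PowerGaugeEulerLiouville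

variable {γ : ℝ} {U V : EuclideanSpace ℝ (Fin 3) → EuclideanSpace ℝ (Fin 3)}
  {P : EuclideanSpace ℝ (Fin 3) → ℝ}

/-! ### The race -/

/-- **THE FEEDING-TIME RACE (ROUND-37 (R)).**  A `C²` self-similar Euler profile (CIV (3.3)) with
`0 < γ < ½`, axisymmetric and swirl-free, with polynomial enstrophy growth on balls and SUPER-POLYNOMIALLY
THIN FAST EXITS (for every `m`, for all large `R`: good squared radii `G ⊆ [R², 4R²]`, `|G| ≥ κR²`, and
a tube `N ⊆ B̄_{2R}` containing every strictly γ-fast point `⟪U z, z⟫ < −γ‖z‖²` of the good spheres,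
with `|N| · ∫_N ‖U‖² ≤ R^{−m}`) is IRROTATIONAL.  See the module docstring for the race.
[cite: ConstantinIgnatovaVicol2026Putative, §3.4.1 eq. (3.21)-(3.22), §3.5] -/
theorem curl_eq_zero_of_thinFastExits (hprof : IsSelfSimilarEulerProfile γ 0 U P) (hγ : 0 < γ)
    (hγ2 : γ < 1 / 2) (hax : IsAxisymmetric U) (hsw : HasNoSwirl U) {CΩ q : ℝ} (hq : 0 ≤ q)
    (hcurl : ∀ L : ℝ, 1 ≤ L →
      ∫ z in closedBall (0 : EuclideanSpace ℝ (Fin 3)) L, ‖curl U z‖ ^ 2 ≤ CΩ * L ^ q)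
    {κ : ℝ} (hκ : 0 < κ)
    (hthin : ∀ m : ℝ, ∃ R₀ : ℝ, ∀ R : ℝ, R₀ ≤ R →
      ∃ (G : Set ℝ) (N : Set (EuclideanSpace ℝ (Fin 3))),
        MeasurableSet G ∧ G ⊆ Icc (R ^ 2) ((2 * R) ^ 2) ∧ κ * R ^ 2 ≤ (volume G).toReal ∧
        MeasurableSet N ∧ N ⊆ closedBall (0 : EuclideanSpace ℝ (Fin 3)) (2 * R) ∧
        (∀ z : EuclideanSpace ℝ (Fin 3), ‖z‖ ^ 2 ∈ G → ⟪U z, z⟫ + γ * ‖z‖ ^ 2 < 0 → z ∈ N) ∧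
        volume N * ∫⁻ z in N, ENNReal.ofReal (‖U z‖ ^ 2) ≤ ENNReal.ofReal (R ^ (-m)))
    (x₀ : EuclideanSpace ℝ (Fin 3)) : curl U x₀ = 0 := by
  by_contra hx₀
  have hU2 : ContDiff ℝ 2 U := hprof.contDiff_velocity
  -- ### the blob
  obtain ⟨ξ₀, r, hξ₀, hr, hr1, hblob⟩ := exists_vortical_ball hU2 hax hsw hx₀
  set B₀ : Set (EuclideanSpace ℝ (Fin 3)) := ball x₀ r with hB₀
  have hB₀m : MeasurableSet B₀ := measurableSet_ball
  have hv₀pos : 0 < volume B₀ := measure_ball_pos volume x₀ hr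
  have hv₀top : volume B₀ < ⊤ := measure_ball_lt_top
  set v₀ : ℝ := (volume B₀).toReal with hv₀
  have hv₀0 : 0 < v₀ := ENNReal.toReal_pos hv₀pos.ne' hv₀top.ne
  -- ### the constants of the race
  have hC : 0 ≤ CΩ := by
    have h1 := hcurl 1 le_rfl
    rw [Real.one_rpow, mul_one] at h1
    exact le_trans (setIntegral_nonneg measurableSet_closedBall fun _ _ => sq_nonneg _) h1
  obtain ⟨s₁, m, Rstar, hs₁, hRstar, hrace⟩ := race_arith hγ hγ2 hq hC hξ₀ hv₀0 hκ
  obtain ⟨R₀, hR₀⟩ := hthin m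
  -- ### the radius
  set R : ℝ := max (max Rstar R₀) (‖x₀‖ + 1) with hRdef
  have hRs : Rstar ≤ R := (le_max_left _ _).trans (le_max_left _ _)
  have hRR₀ : R₀ ≤ R := (le_max_right _ _).trans (le_max_left _ _)
  have hRx : ‖x₀‖ + 1 ≤ R := le_max_right _ _
  have hR1 : 1 ≤ R := hRstar.trans hRs
  have hR0 : 0 < R := by linarith
  obtain ⟨G, N, hGm, hG, hGvol, hNm, hNsub, hLemK, hNJ⟩ := hR₀ R hRR₀
  obtain ⟨hstayb, hexitb⟩ := hrace R hRs
  set S : ℝ := s₁ * Real.log R with hSdef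
  have hS : 0 ≤ S := mul_nonneg hs₁.le (Real.log_nonneg hR1)
  -- ### the cut-off field
  set Rbig : ℝ := 2 * R + 1 with hRbigdef
  obtain ⟨V, hV2, -, -, ⟨K, hK⟩, hVU⟩ := Loc.exists_cutoff_local hU2 (R := Rbig) (by positivity)
  have hRbig : 2 * R < Rbig := by rw [hRbigdef]; linarith
  have hdiv : ∀ z : EuclideanSpace ℝ (Fin 3), ‖z‖ ≤ 2 * R → VectorCalculus.divergence V z = 0 := by
    intro z hz
    have hzball : z ∈ ball (0 : EuclideanSpace ℝ (Fin 3)) Rbig := mem_ball_zero_iff.2 (by linarith)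
    have hev : V =ᶠ[𝓝 z] U := by
      filter_upwards [isOpen_ball.mem_nhds hzball] with w hw using hVU w hw
    unfold VectorCalculus.divergence
    rw [hev.fderiv_eq]
    exact hprof.divFree z
  set Φ := ODE.evolutionMap (fun _ : ℝ => selfSimilarTransport γ 0 V) 0 with hΦ
  -- ### the blob sits in `B̄_R`
  have hB₀R : B₀ ⊆ closedBall (0 : EuclideanSpace ℝ (Fin 3)) R := by
    intro y hy
    rw [hB₀, mem_ball] at hy
    rw [mem_closedBall_zero_iff]
    have h1 : ‖y‖ ≤ ‖y - x₀‖ + ‖x₀‖ := norm_le_norm_sub_add y x₀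
    rw [← dist_eq_norm] at h1
    linarith
  -- ### the enstrophy budget of `B̄_{2R}`
  have hB := hcurl (2 * R) (by linarith)
  -- ### the two halves
  set Stay : Set (EuclideanSpace ℝ (Fin 3)) := {y | ∀ σ ∈ Icc 0 S, ‖Φ (-σ) y‖ ≤ 2 * R} with hStay
  have hStaym : MeasurableSet Stay := (isClosed_backwardStay (γ := γ) hV2 hK S (2 * R)).measurableSet
  have h1 : (volume (B₀ ∩ Stay)).toReal ≤ v₀ / 4 :=
    (volume_stay_le (γ := γ) hprof hax hsw hV2 hK hR0 hRbig hVU hS hB₀m hξ₀ hblob hB).trans hstayb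
  have h2 := ofReal_mul_volume_exit_le (γ := γ) (U := U) hV2 hK hγ hR0 hRbig hVU hdiv hS hB₀m hB₀R hGm hG
    hNm hNsub hLemK
  set cS : ℝ := (Real.exp (3 * γ * S) - 1) / (3 * γ) with hcS
  have hcS0 : 0 ≤ cS := by
    rw [hcS]
    apply div_nonneg _ (by positivity)
    have : 1 ≤ Real.exp (3 * γ * S) := Real.one_le_exp (by positivity)
    linarith
  set g : ℝ := (volume G).toReal / (4 * R) with hg
  have hgκ : κ * R / 4 ≤ g := by
    rw [hg, le_div_iff₀ (by positivity)]
    nlinarith [hGvol, hR0, hκ]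
  have hgpos : 0 < g := lt_of_lt_of_le (by positivity) hgκ
  have hXtop : volume (B₀ \ Stay) ≠ ⊤ :=
    ((measure_mono Set.sdiff_subset).trans_lt hv₀top).ne
  have h3 := toReal_le_of_feeding (N := N) hgpos hcS0 (Real.rpow_nonneg hR0.le (-m)) h2 hNJ
  have h4 : (volume (B₀ \ Stay)).toReal ≤ v₀ / 4 := by
    refine h3.trans (le_trans ?_ hexitb)
    exact div_le_div_of_nonneg_left (by positivity) (by positivity) hgκ
  -- ### the sum
  have hsplit : volume (B₀ ∩ Stay) + volume (B₀ \ Stay) = volume B₀ := measure_inter_add_sdiff B₀ hStaym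
  have hfin1 : volume (B₀ ∩ Stay) ≠ ⊤ := ((measure_mono inter_subset_left).trans_lt hv₀top).ne
  have hsum : v₀ = (volume (B₀ ∩ Stay)).toReal + (volume (B₀ \ Stay)).toReal := by
    rw [hv₀, ← hsplit, ENNReal.toReal_add hfin1 hXtop]
  linarith

end Summit.NavierStokesRegularity.NavierStokesRegularity.Theorems.PowerGaugeEulerLiouville.NeedleRace

end
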